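import Summits.QuantumFields.BalabanUV.Beta.EriceRemainderEnclosureHistoryAutonomyComparisonAgeCompositionDampedLevelGaugePrep

/-!
# EriceRemainderEnclosureHistoryAutonomyComparisonAgeCompositionDampedLevelGauge — (E117b) route (N), first order, DAMPED: **THE END AT EVERY RANGE FOR THE
# DAMPED SYSTEM.**  Along EVERY admissible flow (isotone memory `B` with floor `b > 0` dominating `Σ_k L_k·u_k` on the ages `< K`, `L ≥ 0`, box solution `h`,
# levels `a_n = 1∕h(n)²`), for EVERY sub-profile `O`, EVERY horizon `N ≥ K` and truncation `J ≤ N`, and EVERY family of dampings `0 < g_t ≤ 1` whose defect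
# is at most the row's first entry, **`1 − g_t ≤ F(t) = Σ_{1≤k<K} L_kh(t+k)³∕2`** (the self-consistent pin damping of `HOME/b2b-balaban-beta-d4-p2/g62/e71/
# README.md`, `g = 1∕(1+f)`, `f_t = Σ_k c_{t,k}·Πg ≤ F(t)`, is one), the zero-tailed solution of the DAMPED system
#     `ε(n) = 1_{[0,J]}(n) − Σ_{k∈O} (L_kh(n+k)³∕2)·Σ_{l<k} (Π_{t=n+1+l}^{n+k} g_t)·ε(n+1+l)`
# satisfies  **`ε(m)·h(m)² ≥ ε(m+1)·h(m+1)²` (m < J)**,  **`a_m∕a_J ≤ ε(m) ≤ 1` on `[0,J]`**,  **`0 ≤ ε ≤ 1` everywhere**  (**`flow_damped_level_gauge`**,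
# **`flow_damped_sol_ge_level_ratio`**, **`flow_damped_nonneg_every_range`**).  With (E116d) (the undamped case `g ≡ 1`) this settles conjecture (E58′) of
# route (N) AT FIRST ORDER, damped and undamped, for every admissible profile — the first-order STEP is non-negative at every orbit point.
# THE PROOF is (E116d)'s row induction on «`ε∕a` non-increasing on `[m,J]`» with (E117a)'s general-kernel identity: the damping only LOWERS the first-lag weight
# and the interior heating coefficients (factors `Πg ≤ 1`) and ADDS the defect `c_{m+1,k}(1 − g_{m+k+1}) ≤ c_{m+1,k}F(m+k+1)` to the heating coefficient of age
# `k`; (E117a) `flow_damped_age_ge_two_le` prices first entry + decay + defect per unit of budget share at `Φ ≤ 0.95 < 1`, and the row budget closes the row.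
# README `HOME/b2b-balaban-beta-d4-p2/g97/README.md` §4–§5 (numerics `g97lab7` j343713 ∕ j343714: self-consistent and extremal damping — the level-gauge
# ratio never exceeds 1, per-row margin ≤ 0.52, ε monotone in the depth).

Cell `pub-balaban`, β-function sub-cell, BINDER row D4 «RemainderConst leaves for Bałaban's split» (`HOME/BINDER-OWNERS.md`; owner lineage `b2b-balaban-beta-an4`;
this file by co-owner #2 lineage `b2b-balaban-beta-d4-p2`, generation 97), β-FLOW TEAM duty (1), FREEZE (0) honoured (def-free; imports (E117a)
`…DampedLevelGaugePrep`; uses its `sol_step_eq_general` ∕ `damped_coeff_ge` ∕ `prod_damping_mem` ∕ `flow_damped_age_ge_two_le`, (E116c) `flow_lev_mono` ∕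
`flow_age_one_le`, (E116b) `flow_budget_le`, (E71a) `sol_eq_zero_of_tail`, (E48a) `strictAnti_of_memFlow` BY NAME; nothing restated).

HONEST FRAMING (page 1, verbatim and binding).  *"Discharging BetaPertH makes Bałaban's UV stability UNCONDITIONAL — a real constructive-QFT result; it is
NOT the continuum limit and NOT the Clay problem."*  THIS FILE DISCHARGES NOTHING OF THE KIND.  Elementary real analysis about ABSTRACT functionals on a box
]0,γ]^ℕ with displayed floors, profiles, dampings and signs, and the FIRST-ORDER renewal objects of route (N) built from them — hypotheses of a census, not
facts; the form, signs, ages and moments of Bałaban's (1.22) limit functional are NOT PRINTED ([I] p. 298; GAPS G-t4-U2-1∕-2) and NOT asserted.  Row D4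
class UNCHANGED (critical-path width 0; instance 0∕1; D4 DISCHARGE NO DATE).  HONEST DEPENDENCY: continuum YM on T⁴ ⇐ BetaPertH ∧ nine spine estimates
(0/9 proved); BetaPertH ⇐ (D1) ∧ (D4) ∧ CAP+tail; G-an2-4 gates asym, D1 and NE2/3/4.  NOT settled: dampings violating `1 − g ≤ F` (none arise in route (N));
the NONLINEAR step; anything printed — NOT B12 Thm 2, NOT BetaPertH, NOT continuum, NOT Clay.

WHAT IS PROVED ([folklore]; 0 `def`, 0 sorry).  §1 `sum_indicator_range`, **`damped_row_ge`** (the damped row inequality: `v n ≥ Δe + (1 − F_O(n))·v(n+1) −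
Σ_k (decay + defect)·(interior window)`).  §2 **`flow_damped_level_gauge`**, **`flow_damped_sol_ge_level_ratio`**, **`flow_damped_nonneg_every_range`**.
-/
noncomputable section
open Finset

namespace Summit.QuantumFields.BalabanUV.Beta.EriceRemainderEnclosureHistoryAutonomyComparisonAgeCompositionDampedLevelGauge

open Literature.MathematicalPhysics.QuantumFieldTheory.Balaban1983to89
open Literature.MathematicalPhysics.QuantumFieldTheory.Balaban1983to89.T4BetaStationary
open Literature.MathematicalPhysics.QuantumFieldTheory.Balaban1983to89.T4BetaFlowWellPosed
open Summit.QuantumFields.BalabanUV.Beta.EriceRemainderEnclosureHistoryAutonomyComparisonAgeComposition (sol_eq_zero_of_tail)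
open Summit.QuantumFields.BalabanUV.Beta.EriceRemainderEnclosureHistoryAutonomyComparisonAgeCompositionHeatingCriterionFlow (flow_budget_le)
open Summit.QuantumFields.BalabanUV.Beta.EriceRemainderEnclosureHistoryAutonomyComparisonAgeCompositionLevelGaugePrep (flow_lev_mono flow_age_one_le)
open Summit.QuantumFields.BalabanUV.Beta.EriceRemainderEnclosureHistoryAutonomyComparisonAgeCompositionDampedLevelGaugePrep
  (sol_step_eq_general damped_coeff_ge prod_damping_mem flow_damped_age_ge_two_le)
open Summit.QuantumFields.BalabanUV.Beta.EriceRemainderEnclosureHistoryAutonomyOrder (strictAnti_of_memFlow)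

/-! ## §1 The damped row inequality -/

/-- An indicator-restricted sum over a longer range is the sum over the shorter range. [folklore] -/
theorem sum_indicator_range {f : ℕ → ℝ} {P : ℕ → Prop} [DecidablePred P] {M k : ℕ} (hk : k ≤ M)
    (hP : ∀ j, P j ↔ j < k) :
    ∑ j ∈ range M, (if P j then f j else 0) = ∑ j ∈ range k, f j := by
  rw [← sum_filter]
  congr 1
  ext j
  simp only [mem_filter, mem_range, hP]
  omega

/-- **THE DAMPED ROW INEQUALITY.**  Damped sub-profile kernel `KO n l = Σ_{k∈[1,K)} KD k n l`, `KD k n l = [k ∈ O ∧ k < K ∧ l < k]·(L_kh(n+k)³∕2)·Π_{t∈[n+1+l,n+k]}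
g_t` (`L ≥ 0`, `h > 0` non-increasing, `0 < g ≤ 1`), reads on the horizon `N ≥ K`, `N ≥ 1`, and `v n = e n − R v n` with `v ≥ 0` at the depths `≥ n+1` and
`v(n+1+N) = 0`.  Then
`v n ≥ (e n − e(n+1)) + (1 − Σ_k [k∈O]·L_kh(n+k)³∕2)·v(n+1) − Σ_k [k∈O]·(L_kh(n+k)³∕2 − L_kh(n+1+k)³∕2 + (L_kh(n+1+k)³∕2)(1 − g(n+k+1)))·Σ_{j<k−1} v(n+2+j)`
— (E117a) `sol_step_eq_general` with the outflow dropped by sign, the damped first lag bounded by the undamped one, and `damped_coeff_ge` cell by cell. [folklore] -/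
theorem damped_row_ge {L h g : ℕ → ℝ} {K N : ℕ} {O : Finset ℕ} (hL : ∀ k, 0 ≤ L k) (hh0 : ∀ n, 0 < h n) (hanti : Antitone h)
    (hg : ∀ t, 0 < g t ∧ g t ≤ 1) (hN : 1 ≤ N) (hKN : K ≤ N)
    {KD : ℕ → ℕ → ℕ → ℝ}
    (hKD : ∀ k n l, KD k n l = if k ∈ O ∧ k < K ∧ l < k then L k * h (n + k) ^ 3 / 2 * ∏ t ∈ Ico (n + 1 + l) (n + k + 1), g t else 0)
    {KO : ℕ → ℕ → ℝ} (hKO : ∀ n l, KO n l = ∑ k ∈ Ico 1 K, KD k n l)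
    {R : (ℕ → ℝ) → ℕ → ℝ} (hR : ∀ u m, R u m = ∑ l ∈ range N, KO m l * u (m + 1 + l))
    {e v : ℕ → ℝ} (hrec : ∀ m, v m = e m - R v m) (n : ℕ) (hv0 : ∀ p, n + 1 ≤ p → 0 ≤ v p) (hvN : v (n + 1 + N) = 0) :
    (e n - e (n + 1)) + (1 - ∑ k ∈ Ico 1 K, (if k ∈ O then L k * h (n + k) ^ 3 / 2 else 0)) * v (n + 1)
      - ∑ k ∈ Ico 1 K, (if k ∈ O then L k * h (n + k) ^ 3 / 2 - L k * h (n + 1 + k) ^ 3 / 2 + L k * h (n + 1 + k) ^ 3 / 2 * (1 - g (n + k + 1)) else 0)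
          * ∑ j ∈ range (k - 1), v (n + 2 + j) ≤ v n := by
  have hid := sol_step_eq_general hN hR hrec n
  have hc0 : ∀ k p, 0 ≤ L k * h (p + k) ^ 3 / 2 := fun k p => by have := hL k; have := hh0 (p + k); positivity
  -- the last term vanishes
  rw [hvN, mul_zero, add_zero] at hid
  -- the damped first lag is at most the undamped first entry
  have hK0 : KO n 0 ≤ ∑ k ∈ Ico 1 K, (if k ∈ O then L k * h (n + k) ^ 3 / 2 else 0) := by
    rw [hKO]
    refine sum_le_sum fun k hk => ?_
    rw [hKD]
    have hk1 : 1 ≤ k := (mem_Ico.mp hk).1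
    have hkK : k < K := (mem_Ico.mp hk).2
    by_cases hkO : k ∈ O
    · rw [if_pos ⟨hkO, hkK, by omega⟩, if_pos hkO]
      calc L k * h (n + k) ^ 3 / 2 * ∏ t ∈ Ico (n + 1 + 0) (n + k + 1), g t ≤ L k * h (n + k) ^ 3 / 2 * 1 :=
            mul_le_mul_of_nonneg_left (prod_damping_mem hg _).2 (hc0 k n)
        _ = L k * h (n + k) ^ 3 / 2 := mul_one _
    · rw [if_neg (show ¬ (k ∈ O ∧ k < K ∧ 0 < k) by tauto), if_neg hkO]
  have hv1 : 0 ≤ v (n + 1) := hv0 (n + 1) le_rfl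
  have hpers : (1 - ∑ k ∈ Ico 1 K, (if k ∈ O then L k * h (n + k) ^ 3 / 2 else 0)) * v (n + 1) ≤ (1 - KO n 0) * v (n + 1) :=
    mul_le_mul_of_nonneg_right (by linarith) hv1
  -- the coefficients, cell by cell and age by age
  set dd : ℕ → ℝ := fun k => L k * h (n + k) ^ 3 / 2 - L k * h (n + 1 + k) ^ 3 / 2 + L k * h (n + 1 + k) ^ 3 / 2 * (1 - g (n + k + 1)) with hdd
  have hdd' : ∀ k, dd k = L k * h (n + k) ^ 3 / 2 - L k * h (n + 1 + k) ^ 3 / 2 * g (n + k + 1) := fun k => by simp only [hdd]; ring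
  have hcell : ∀ j ∈ range (N - 1),
      -(∑ k ∈ Ico 1 K, (if k ∈ O ∧ k < K ∧ j + 1 < k then dd k else 0) * v (n + 2 + j)) ≤ (KO (n + 1) j - KO n (j + 1)) * v (n + 2 + j) := by
    intro j _
    have hvj : 0 ≤ v (n + 2 + j) := hv0 _ (by omega)
    have hco : -(∑ k ∈ Ico 1 K, (if k ∈ O ∧ k < K ∧ j + 1 < k then dd k else 0)) ≤ KO (n + 1) j - KO n (j + 1) := by
      rw [hKO, hKO, ← sum_sub_distrib, ← sum_neg_distrib]
      refine sum_le_sum fun k _ => ?_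
      have := damped_coeff_ge (O := O) (K := K) hL hh0 hanti hg (k := k) (KD := KD k) (fun n' l => hKD k n' l) n j
      rw [← hdd' k] at this
      exact this
    rw [← sum_mul, ← neg_mul]
    exact mul_le_mul_of_nonneg_right hco hvj
  have hsumcells : -(∑ j ∈ range (N - 1), ∑ k ∈ Ico 1 K, (if k ∈ O ∧ k < K ∧ j + 1 < k then dd k else 0) * v (n + 2 + j))
      ≤ ∑ j ∈ range (N - 1), (KO (n + 1) j - KO n (j + 1)) * v (n + 2 + j) := by
    rw [← sum_neg_distrib]; exact sum_le_sum hcell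
  -- exchange the sums and identify the interior windows
  have hswap : ∑ j ∈ range (N - 1), ∑ k ∈ Ico 1 K, (if k ∈ O ∧ k < K ∧ j + 1 < k then dd k else 0) * v (n + 2 + j)
      = ∑ k ∈ Ico 1 K, (if k ∈ O then dd k else 0) * ∑ j ∈ range (k - 1), v (n + 2 + j) := by
    rw [sum_comm]
    refine sum_congr rfl fun k hk => ?_
    have hkK : k < K := (mem_Ico.mp hk).2
    have hk1 : 1 ≤ k := (mem_Ico.mp hk).1
    by_cases hkO : k ∈ O
    · rw [if_pos hkO, mul_sum]
      rw [← sum_indicator_range (f := fun j => dd k * v (n + 2 + j)) (P := fun j => k ∈ O ∧ k < K ∧ j + 1 < k) (M := N - 1) (k := k - 1)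
        (by omega) (fun j => ⟨fun h => by omega, fun h => ⟨hkO, hkK, by omega⟩⟩)]
      refine sum_congr rfl fun j _ => ?_
      split_ifs <;> ring
    · rw [if_neg hkO, zero_mul]
      exact sum_eq_zero fun j _ => by rw [if_neg (show ¬ (k ∈ O ∧ k < K ∧ j + 1 < k) by tauto), zero_mul]
  rw [hswap] at hsumcells
  have hdd_if : ∀ k, (if k ∈ O then dd k else 0)
      = (if k ∈ O then L k * h (n + k) ^ 3 / 2 - L k * h (n + 1 + k) ^ 3 / 2 + L k * h (n + 1 + k) ^ 3 / 2 * (1 - g (n + k + 1)) else 0) := fun k => by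
    simp only [hdd]
  simp only [hdd_if] at hsumcells
  linarith

/-! ## §2 The damped every-range END -/

variable {B : (ℕ → ℝ) → ℝ} {γ b gIR : ℝ} {L : ℕ → ℝ} {K : ℕ} {h g : ℕ → ℝ}

/-- **THE LEVEL GAUGE FOR THE DAMPED SYSTEM.**  `B` isotone with floor `b > 0` dominating `L ≥ 0` on the ages `< K`; `h` a box solution; dampings `0 < g ≤ 1`
with `1 − g_t ≤ Σ_{1≤k<K} L_kh(t+k)³∕2`; `O` any finite set of loaded ages with the damped kernel `KD`∕`KO` as displayed; horizon `N ≥ K`, `N ≥ 1`; `ε` the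
zero-tailed solution of `ε = 1_{[0,J]} − R ε`, `J ≤ N`.  Then for every `m < J`:  `ε(m+1)·h(m+1)² ≤ ε(m)·h(m)²`. [folklore] -/
theorem flow_damped_level_gauge (hmono : ∀ u v : ℕ → ℝ, SeqBox γ u → SeqBox γ v → (∀ j, u j ≤ v j) → B u ≤ B v)
    (hL : ∀ k, 0 ≤ L k) (hb : 0 < b) (hlo : ∀ u, SeqBox γ u → b ≤ B u) (hdom : ∀ u, SeqBox γ u → ∑ k ∈ range K, L k * u k ≤ B u)
    (hh : SeqBox γ h) (hf : MemFlow B gIR h) (hg : ∀ t, 0 < g t ∧ g t ≤ 1) (hgF : ∀ t, 1 - g t ≤ ∑ k ∈ Ico 1 K, L k * h (t + k) ^ 3 / 2)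
    (O : Finset ℕ) {KD : ℕ → ℕ → ℕ → ℝ}
    (hKD : ∀ k n l, KD k n l = if k ∈ O ∧ k < K ∧ l < k then L k * h (n + k) ^ 3 / 2 * ∏ t ∈ Ico (n + 1 + l) (n + k + 1), g t else 0)
    {N : ℕ} (hN : 1 ≤ N) (hKN : K ≤ N) {KO : ℕ → ℕ → ℝ} (hKO : ∀ n l, KO n l = ∑ k ∈ Ico 1 K, KD k n l)
    {R : (ℕ → ℝ) → ℕ → ℝ} (hR : ∀ u m, R u m = ∑ l ∈ range N, KO m l * u (m + 1 + l))
    {J : ℕ} (hJN : J ≤ N) {ε : ℕ → ℝ} (hεt : ∀ m, N < m → ε m = 0)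
    (hεrec : ∀ m, ε m = (fun n => if n ≤ J then (1 : ℝ) else 0) m - R ε m) :
    ∀ m, m < J → ε (m + 1) * h (m + 1) ^ 2 ≤ ε m * h m ^ 2 := by
  set e : ℕ → ℝ := fun n => if n ≤ J then (1 : ℝ) else 0 with he_def
  have hpos : ∀ j, 0 < h j := fun j => (hh j).1
  have hanti := (strictAnti_of_memFlow hb hlo hh hf).antitone
  -- support beyond J and the value at J
  have het : ∀ n, N < n + (N - J) → e n = 0 := fun n hn => if_neg (show ¬ n ≤ J by omega)
  have hεJ : ∀ n, J < n → ε n = 0 := fun n hn => sol_eq_zero_of_tail hR hεt hεrec het n (by omega)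
  have hεJ1 : ε J = 1 := by
    rw [hεrec J]
    have hRJ : R ε J = 0 := by
      rw [hR]; exact sum_eq_zero fun l _ => by rw [hεJ (J + 1 + l) (by omega), mul_zero]
    simp only [he_def, hRJ, if_pos le_rfl, sub_zero]
  suffices hmain : ∀ d m, J ≤ m + d → ∀ n, m ≤ n → n < J → ε (n + 1) * h (n + 1) ^ 2 ≤ ε n * h n ^ 2 from
    fun m hm => hmain J 0 (by omega) m (Nat.zero_le m) hm
  intro d
  induction d with
  | zero => intro m hm n hmn hnJ; omega
  | succ d ih =>
    intro m hm n hmn hnJ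
    by_cases hmn' : m + 1 ≤ n
    · exact ih (m + 1) (by omega) n hmn' hnJ
    have hnm : n = m := by omega
    subst hnm
    have hbelow : ∀ p, n + 1 ≤ p → p < J → ε (p + 1) * h (p + 1) ^ 2 ≤ ε p * h p ^ 2 := ih (n + 1) (by omega)
    have hchain : ∀ p, n + 1 ≤ p → ∀ q, p + q ≤ J → ε (p + q) * h (p + q) ^ 2 ≤ ε p * h p ^ 2 := by
      intro p hp q
      induction q with
      | zero => intro _; simp
      | succ q ihq =>
        intro hq
        have h1 := hbelow (p + q) (by omega) (by omega)
        rw [show p + (q + 1) = p + q + 1 by ring]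
        exact h1.trans (ihq (by omega))
    have hposJ : ∀ p, n + 1 ≤ p → p ≤ J → 0 < ε p := by
      intro p hp1 hpJ
      have := hchain p hp1 (J - p) (by omega)
      rw [show p + (J - p) = J by omega, hεJ1, one_mul] at this
      have hp2 : 0 < h p ^ 2 := pow_pos (hpos p) 2
      by_contra hneg
      have hneg' : ε p ≤ 0 := le_of_not_gt hneg
      have : ε p * h p ^ 2 ≤ 0 := mul_nonpos_of_nonpos_of_nonneg hneg' hp2.le
      linarith [pow_pos (hpos J) 2]
    have hnonneg : ∀ p, n + 1 ≤ p → 0 ≤ ε p := by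
      intro p hp
      by_cases hpJ : p ≤ J
      · exact (hposJ p hp hpJ).le
      · rw [hεJ p (by omega)]
    have hε1 : 0 ≤ ε (n + 1) := hnonneg (n + 1) le_rfl
    have hgauge : ∀ l, ε (n + 1 + l) ≤ ε (n + 1) * h (n + 1) ^ 2 * (1 / h (n + 1 + l) ^ 2) := by
      intro l
      have hl2 : 0 < h (n + 1 + l) ^ 2 := pow_pos (hpos _) 2
      by_cases hl : n + 1 + l ≤ J
      · have := hchain (n + 1) le_rfl l hl
        rw [mul_one_div, le_div_iff₀ hl2]; exact this
      · rw [hεJ (n + 1 + l) (by omega)]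
        have := hpos (n + 1); positivity
    -- the damped row inequality
    have hrow := damped_row_ge (e := e) hL hpos hanti hg hN hKN hKD hKO hR hεrec n hnonneg (hεt _ (by omega))
    have hen : e n - e (n + 1) = 0 := by simp only [he_def]; rw [if_pos (by omega), if_pos (by omega)]; ring
    rw [hen, zero_add] at hrow
    -- per-age costs
    have hcost : ∑ k ∈ Ico 1 K, (if k ∈ O then L k * h (n + k) ^ 3 / 2 else 0) * ε (n + 1)
        + ∑ k ∈ Ico 1 K, (if k ∈ O then L k * h (n + k) ^ 3 / 2 - L k * h (n + 1 + k) ^ 3 / 2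
              + L k * h (n + 1 + k) ^ 3 / 2 * (1 - g (n + k + 1)) else 0) * ∑ j ∈ range (k - 1), ε (n + 2 + j)
        ≤ (∑ k ∈ Ico 1 K, (if k ∈ O then L k * h (n + 1 + k) else 0)) * h (n + 1) ^ 2 * ε (n + 1) := by
      rw [← sum_add_distrib, sum_mul, sum_mul]
      refine sum_le_sum fun k hk => ?_
      have hk1 : 1 ≤ k := (mem_Ico.mp hk).1
      by_cases hkO : k ∈ O
      · rw [if_pos hkO, if_pos hkO, if_pos hkO]
        by_cases hk2 : 2 ≤ k
        · -- reindex the interior window: Σ_{j<k−1} ε(n+2+j) = Σ_{l∈[1,k)} ε(n+1+l)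
          have hwin : ∑ j ∈ range (k - 1), ε (n + 2 + j) = ∑ l ∈ Ico 1 k, ε (n + 1 + l) := by
            rw [sum_Ico_eq_sum_range, show k - 1 = k - 1 from rfl]
            exact sum_congr rfl fun j _ => by rw [show n + 1 + (1 + j) = n + 2 + j by ring]
          rw [hwin]
          have hS0 : 0 ≤ ∑ l ∈ Ico 1 k, ε (n + 1 + l) := sum_nonneg fun l _ => hnonneg _ (by omega)
          have hS : ∑ l ∈ Ico 1 k, ε (n + 1 + l) ≤ ε (n + 1) * h (n + 1) ^ 2 * ∑ l ∈ Ico 1 k, 1 / h (n + 1 + l) ^ 2 := by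
            rw [mul_sum]; exact sum_le_sum fun l _ => hgauge l
          have hθ0 : 0 ≤ 1 - g (n + k + 1) := by linarith [(hg (n + k + 1)).2]
          have hθ : 1 - g (n + k + 1) ≤ ∑ q ∈ Ico 1 K, L q * h (n + k + 1 + q) ^ 3 / 2 := hgF (n + k + 1)
          have := flow_damped_age_ge_two_le hmono hL hb hlo hdom hh hf n hk2 hε1 hS0 hS hθ0 hθ
          linarith
        · have hk1' : k = 1 := by omega
          subst hk1'
          have hempty : ∑ j ∈ range (1 - 1), ε (n + 2 + j) = 0 := by simp
          rw [hempty, mul_zero, add_zero]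
          have := flow_age_one_le hmono hL hb hlo hh hf n
          exact mul_le_mul_of_nonneg_right (by linarith) hε1
      · rw [if_neg hkO, if_neg hkO, if_neg hkO]; simp
    -- the budget of the row n+1
    have hbud : (∑ k ∈ Ico 1 K, (if k ∈ O then L k * h (n + 1 + k) else 0)) ≤ 1 / h (n + 1) ^ 2 - 1 / h n ^ 2 := by
      have hb' := flow_budget_le hdom hh hf n
      refine le_trans ?_ hb'
      calc ∑ k ∈ Ico 1 K, (if k ∈ O then L k * h (n + 1 + k) else 0) ≤ ∑ k ∈ Ico 1 K, L k * h (n + 1 + k) :=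
            sum_le_sum fun k _ => by
              split_ifs
              · exact le_rfl
              · exact mul_nonneg (hL k) (hpos _).le
        _ ≤ ∑ k ∈ range K, L k * h (n + 1 + k) := by
            refine sum_le_sum_of_subset_of_nonneg (fun k hk => mem_range.mpr (mem_Ico.mp hk).2) ?_
            intro k _ _; exact mul_nonneg (hL k) (hpos _).le
    have hn2 : 0 < h n ^ 2 := pow_pos (hpos n) 2
    have hn12 : 0 < h (n + 1) ^ 2 := pow_pos (hpos (n + 1)) 2
    have hstep : ε (n + 1) * h (n + 1) ^ 2 * (1 / h n ^ 2) ≤ ε n := by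
      have h1 : (∑ k ∈ Ico 1 K, (if k ∈ O then L k * h (n + 1 + k) else 0)) * h (n + 1) ^ 2 * ε (n + 1)
          ≤ (1 / h (n + 1) ^ 2 - 1 / h n ^ 2) * h (n + 1) ^ 2 * ε (n + 1) :=
        mul_le_mul_of_nonneg_right (mul_le_mul_of_nonneg_right hbud hn12.le) hε1
      have e0 : (1 / h (n + 1) ^ 2 - 1 / h n ^ 2) * h (n + 1) ^ 2 = 1 - h (n + 1) ^ 2 * (1 / h n ^ 2) := by
        rw [sub_mul, one_div_mul_cancel (ne_of_gt hn12), mul_comm]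
      rw [e0] at h1
      have hF : (∑ k ∈ Ico 1 K, (if k ∈ O then L k * h (n + k) ^ 3 / 2 else 0)) * ε (n + 1)
          = ∑ k ∈ Ico 1 K, (if k ∈ O then L k * h (n + k) ^ 3 / 2 else 0) * ε (n + 1) := by rw [sum_mul]
      nlinarith
    have e2 : ε (n + 1) * h (n + 1) ^ 2 * (1 / h n ^ 2) * h n ^ 2 = ε (n + 1) * h (n + 1) ^ 2 := by
      rw [mul_assoc, one_div_mul_cancel (ne_of_gt hn2), mul_one]
    have := mul_le_mul_of_nonneg_right hstep hn2.le
    rw [e2] at this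
    exact this

/-- **THE QUANTITATIVE DAMPED END: `a_m∕a_J ≤ ε(m)`** for `m ≤ J`. [folklore] -/
theorem flow_damped_sol_ge_level_ratio (hmono : ∀ u v : ℕ → ℝ, SeqBox γ u → SeqBox γ v → (∀ j, u j ≤ v j) → B u ≤ B v)
    (hL : ∀ k, 0 ≤ L k) (hb : 0 < b) (hlo : ∀ u, SeqBox γ u → b ≤ B u) (hdom : ∀ u, SeqBox γ u → ∑ k ∈ range K, L k * u k ≤ B u)
    (hh : SeqBox γ h) (hf : MemFlow B gIR h) (hg : ∀ t, 0 < g t ∧ g t ≤ 1) (hgF : ∀ t, 1 - g t ≤ ∑ k ∈ Ico 1 K, L k * h (t + k) ^ 3 / 2)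
    (O : Finset ℕ) {KD : ℕ → ℕ → ℕ → ℝ}
    (hKD : ∀ k n l, KD k n l = if k ∈ O ∧ k < K ∧ l < k then L k * h (n + k) ^ 3 / 2 * ∏ t ∈ Ico (n + 1 + l) (n + k + 1), g t else 0)
    {N : ℕ} (hN : 1 ≤ N) (hKN : K ≤ N) {KO : ℕ → ℕ → ℝ} (hKO : ∀ n l, KO n l = ∑ k ∈ Ico 1 K, KD k n l)
    {R : (ℕ → ℝ) → ℕ → ℝ} (hR : ∀ u m, R u m = ∑ l ∈ range N, KO m l * u (m + 1 + l))
    {J : ℕ} (hJN : J ≤ N) {ε : ℕ → ℝ} (hεt : ∀ m, N < m → ε m = 0)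
    (hεrec : ∀ m, ε m = (fun n => if n ≤ J then (1 : ℝ) else 0) m - R ε m) :
    ∀ m, m ≤ J → h J ^ 2 / h m ^ 2 ≤ ε m := by
  have hpos : ∀ j, 0 < h j := fun j => (hh j).1
  have hgau := flow_damped_level_gauge hmono hL hb hlo hdom hh hf hg hgF O hKD hN hKN hKO hR hJN hεt hεrec
  have het : ∀ n, N < n + (N - J) → (fun n => if n ≤ J then (1 : ℝ) else 0) n = 0 := fun n hn => if_neg (show ¬ n ≤ J by omega)
  have hεJ : ∀ n, J < n → ε n = 0 := fun n hn => sol_eq_zero_of_tail hR hεt hεrec het n (by omega)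
  have hεJ1 : ε J = 1 := by
    rw [hεrec J]
    have hRJ : R ε J = 0 := by
      rw [hR]; exact sum_eq_zero fun l _ => by rw [hεJ (J + 1 + l) (by omega), mul_zero]
    simp only [hRJ, if_pos le_rfl, sub_zero]
  have hch : ∀ q m, m + q = J → h J ^ 2 ≤ ε m * h m ^ 2 := by
    intro q
    induction q with
    | zero => intro m hm; rw [add_zero] at hm; subst hm; rw [hεJ1, one_mul]
    | succ q ih =>
      intro m hm
      have h1 := hgau m (by omega)
      have h2 := ih (m + 1) (by omega)
      linarith
  intro m hm
  have := hch (J - m) m (by omega)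
  rw [div_le_iff₀ (pow_pos (hpos m) 2)]
  linarith

/-- **THE DAMPED END AT EVERY RANGE: `0 ≤ ε ≤ 1`** at every depth, for every admissible flow, sub-profile, horizon `N ≥ K`, truncation `J ≤ N` and every
family of dampings `0 < g ≤ 1` with `1 − g ≤ F`. [folklore] -/
theorem flow_damped_nonneg_every_range (hmono : ∀ u v : ℕ → ℝ, SeqBox γ u → SeqBox γ v → (∀ j, u j ≤ v j) → B u ≤ B v)
    (hL : ∀ k, 0 ≤ L k) (hb : 0 < b) (hlo : ∀ u, SeqBox γ u → b ≤ B u) (hdom : ∀ u, SeqBox γ u → ∑ k ∈ range K, L k * u k ≤ B u)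
    (hh : SeqBox γ h) (hf : MemFlow B gIR h) (hg : ∀ t, 0 < g t ∧ g t ≤ 1) (hgF : ∀ t, 1 - g t ≤ ∑ k ∈ Ico 1 K, L k * h (t + k) ^ 3 / 2)
    (O : Finset ℕ) {KD : ℕ → ℕ → ℕ → ℝ}
    (hKD : ∀ k n l, KD k n l = if k ∈ O ∧ k < K ∧ l < k then L k * h (n + k) ^ 3 / 2 * ∏ t ∈ Ico (n + 1 + l) (n + k + 1), g t else 0)
    {N : ℕ} (hN : 1 ≤ N) (hKN : K ≤ N) {KO : ℕ → ℕ → ℝ} (hKO : ∀ n l, KO n l = ∑ k ∈ Ico 1 K, KD k n l)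
    {R : (ℕ → ℝ) → ℕ → ℝ} (hR : ∀ u m, R u m = ∑ l ∈ range N, KO m l * u (m + 1 + l))
    {J : ℕ} (hJN : J ≤ N) {ε : ℕ → ℝ} (hεt : ∀ m, N < m → ε m = 0)
    (hεrec : ∀ m, ε m = (fun n => if n ≤ J then (1 : ℝ) else 0) m - R ε m) :
    ∀ m, 0 ≤ ε m ∧ ε m ≤ 1 := by
  have hpos : ∀ j, 0 < h j := fun j => (hh j).1
  have hlow := flow_damped_sol_ge_level_ratio hmono hL hb hlo hdom hh hf hg hgF O hKD hN hKN hKO hR hJN hεt hεrec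
  have het : ∀ n, N < n + (N - J) → (fun n => if n ≤ J then (1 : ℝ) else 0) n = 0 := fun n hn => if_neg (show ¬ n ≤ J by omega)
  have hεJ : ∀ n, J < n → ε n = 0 := fun n hn => sol_eq_zero_of_tail hR hεt hεrec het n (by omega)
  have hnn : ∀ m, 0 ≤ ε m := by
    intro m
    by_cases hm : m ≤ J
    · exact le_trans (by have := hpos J; have := hpos m; positivity) (hlow m hm)
    · rw [hεJ m (by omega)]
  -- the upper bound: the reads are non-negative
  have hKD0 : ∀ k p l, 0 ≤ KD k p l := fun k p l => by
    rw [hKD]; split_ifs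
    · exact mul_nonneg (by have := hL k; have := hpos (p + k); positivity) (prod_damping_mem hg _).1.le
    · exact le_rfl
  intro m
  refine ⟨hnn m, ?_⟩
  have hR0 : 0 ≤ R ε m := by
    rw [hR]; exact sum_nonneg fun l _ => mul_nonneg (by rw [hKO]; exact sum_nonneg fun k _ => hKD0 k m l) (hnn _)
  have h2 : (fun n => if n ≤ J then (1 : ℝ) else 0) m ≤ 1 := by simp only; split_ifs <;> norm_num
  linarith [hεrec m]

end Summit.QuantumFields.BalabanUV.Beta.EriceRemainderEnclosureHistoryAutonomyComparisonAgeCompositionDampedLevelGauge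

end
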